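import Mathlib
import Summits.NavierStokesRegularity.NavierStokesRegularity.Theorems.PoloidalWindowDoorPoloidalWindowRigidityZShockTurningShearQuadratic

/-!
# Crux K2 `PoloidalWindowRigidity` (stmt-NavierStokesRegularity-19708), line `z_shock` — R3 inhabitant census: QUADRATIC SLICES
# WITH AN ARBITRARY STRUCTURE FUNCTION (III) — a definite quadratic slice at ONE height forces the structure function to be
# affine on its value range

`--supports stmt-NavierStokesRegularity-19708 --as helper` (leafhand-ns-poloidalwindowdoor-3 g21, cell decomp-ns, 2026-09-01).  Class-free,
def-free; Mathlib + part II (`…ZShockTurningShearQuadratic`, p839549, imported for the sequel).  **No stub and no summit is closed by this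
file; Navier–Stokes regularity is NOT proved here (rung 0).**

Parts I–II (`…ZShockTurningShear`, `…ZShockTurningShearQuadratic`, hand 3-g19) settled the affine and the quadratic slices
`W(s,y) = A + By₀ + Cy₁ + ½(Dy₀² + 2Ey₀y₁ + Gy₁²)` of the autonomous height-evolution `∂ₛ∂ₛW = γ(W)ΔW + γ'(W)|∇W|²`
(`…ZShockSliceTyping.slice_wave_pde`; `γ` the squared characteristic speed, `γ' ≢ 0` = THICK) for an AFFINE structure function
`γ(t) = γ₀ + 2μt`, and left the general structure function as the next census item («quadratic slices with general γ», exit report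
3-g19).  This part removes the restriction on `γ` for slices with a DEFINITE quadratic part, by a SINGLE-HEIGHT argument; the sequel
`…ZShockTurningShearDefiniteHeights` draws the all-heights consequence (definite quadratic-slice patterns live on the (TH) column).

* `eq_affine_of_deriv_eq_Ioi`, `deriv_eq_of_affine_Ici`, `isotropic_kernel`, `deriv_eq_of_two_rays` — one-variable kernels (mean value
  theorem; one-sided uniqueness of derivatives; the linear first-order identity `T(γ + τγ') = l + ρτ` on `τ ≥ 0`; two ray identities with
  different weights pin `γ'`).
* ★ `quadSlice_posDef_affine` — **single-height rigidity.**  Let `γ` be differentiable (derivative `γ'` given pointwise) and suppose that at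
  ONE height the quadratic slice with `D > 0`, `DG − E² > 0` satisfies the height-evolution, i.e. the identity
  `ℓ(y) = γ(W(y))·(D + G) + γ'(W(y))·|∇W(y)|²` for all `y ∈ ℝ²` with SOME quadratic polynomial `ℓ` (the would-be `∂ₛ∂ₛW`).  Then, with
  `m = min W` (attained at the centre `c`, `∇W(c) = 0`): `W ≥ m`, `|∇W|² ≤ 2(D+G)(W − m)`, and `γ` IS AFFINE ON THE VALUE RANGE `[m, ∞)`:
  `γ(m + τ) = γ₀ + 2μ(m + τ)` (`τ ≥ 0`), `γ'(m + τ) = 2μ` (`τ > 0`).  Proof: along the rays `y = c ± t·d` one has `W = m + ½t²q_d`,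
  `|∇W|² = t²p_d` (`q_d = dᵀQd`, `p_d = |Qd|²`), and adding the identity at `±t` kills the odd part of `ℓ`:
  `(D+G)γ(m+τ) + (2p_d/q_d)·τ·γ'(m+τ) = ℓ(c) + (r_d/q_d)τ` for all `τ ≥ 0`.  Two directions with different weights `2p_d/q_d` give `γ'`
  constant on `(m, ∞)`; the weights of `d = e₀, e₁, e₀+e₁` all agree iff `Q² = κQ` on three independent directions iff `Q` is ISOTROPIC
  (`D = G`, `E = 0`), and then the weight equals `D + G` and the single identity `T(γ + τγ') = ℓ(c) + ρτ` integrates (`(τγ(m+τ))' =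
  (ℓ(c) + ρτ)/T`, value at `τ = 0`) to an affine `γ`.  No boundedness, no sign of `γ`, no second height.

Not treated (named, not hidden): slices whose quadratic part is INDEFINITE or DEGENERATE (rank one) — the ray identities still hold there
(`q_d` of both signs / a null direction) and the two-weights argument applies on each side of `m`, but the value-range bookkeeping differs and
is left to a sequel.  Honest scope: a toy sub-family of R3 (`hGN` stays XL, not in print); kinematic (no NS); the substitution of the ansatz
is the displayed identity, taken as hypothesis.  presearch: «polynomial-in-x solutions of quasilinear wave equations u_tt = (γ(u)u_x)_x /
invariant subspaces of quadratic polynomials» → invariant-subspace method (Galaktionov–Svirshchevskii) for POLYNOMIAL nonlinearities only;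
nothing for a general structure function; crux records (`rg` over `Cruxes/PoloidalWindowRigidity/**`, `Theorems/…ZShock*`): quadratic slices
only in part II. [folklore]
-/
noncomputable section

namespace Summit.NavierStokesRegularity.NavierStokesRegularity.Theorems.PoloidalWindowDoorPoloidalWindowRigidityZShockTurningShearDefinite

-- the summit and its single sub-problem share the name (CONVENTIONS §1)
set_option linter.dupNamespace false

open Set Filter Topology
open Summit.NavierStokesRegularity.NavierStokesRegularity.Theorems.PoloidalWindowDoorPoloidalWindowRigidityZShockTurningShearQuadratic

/-! ## One-variable kernels -/

/-- **Constant derivative on an open half-line ⇒ affine on the closed half-line** (mean value theorem on `[m, m + τ]`). [folklore] -/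
theorem eq_affine_of_deriv_eq_Ioi {γ γ' : ℝ → ℝ} {m k : ℝ} (hγ : ∀ t, HasDerivAt γ (γ' t) t)
    (hk : ∀ τ, 0 < τ → γ' (m + τ) = k) : ∀ τ, 0 ≤ τ → γ (m + τ) = γ m + k * τ := by
  intro τ hτ
  rcases hτ.eq_or_lt with h | hτpos
  · rw [← h, add_zero, mul_zero, add_zero]
  · have hφ : ∀ t, HasDerivAt (fun t => γ t - k * t) (γ' t - k) t := fun t =>
      (hγ t).fun_sub (hasDerivAt_const_mul k)
    obtain ⟨ξ, hξ, hslope⟩ := exists_hasDerivAt_eq_slope (fun t => γ t - k * t) (fun t => γ' t - k)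
      (by linarith : m < m + τ) (fun t _ => (hφ t).continuousAt.continuousWithinAt) (fun t _ => hφ t)
    have h1 : γ' ξ = k := by
      have h2 := hk (ξ - m) (by linarith [hξ.1])
      have h3 : m + (ξ - m) = ξ := by ring
      rwa [h3] at h2
    rw [h1, sub_self] at hslope
    have hne : m + τ - m ≠ 0 := by linarith
    have h3 : γ (m + τ) - k * (m + τ) - (γ m - k * m) = 0 := by
      rcases (div_eq_zero_iff.mp hslope.symm) with h | h
      · exact h
      · exact absurd h hne
    linarith

/-- **One-sided uniqueness of the derivative.**  If `γ` is differentiable at `t₀` and affine with slope `k` on `[t₀, ∞)`, then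
`γ'(t₀) = k` (derivatives within `Ici t₀` are unique). [folklore] -/
theorem deriv_eq_of_affine_Ici {γ γ' : ℝ → ℝ} {t₀ γ₀ k : ℝ} (hγ : HasDerivAt γ (γ' t₀) t₀)
    (h : ∀ τ, 0 ≤ τ → γ (t₀ + τ) = γ₀ + k * τ) : γ' t₀ = k := by
  have h1 : HasDerivWithinAt γ (γ' t₀) (Ici t₀) t₀ := hγ.hasDerivWithinAt
  have h2 : HasDerivAt (fun t => γ₀ + k * (t - t₀)) k t₀ := by
    have h := (((hasDerivAt_id t₀).sub_const t₀).const_mul k).const_add γ₀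
    simpa using h
  have h3 : HasDerivWithinAt γ k (Ici t₀) t₀ := by
    refine h2.hasDerivWithinAt.congr_of_mem (fun t ht => ?_) self_mem_Ici
    have h4 := h (t - t₀) (by simpa [sub_nonneg] using ht)
    have h5 : t₀ + (t - t₀) = t := by ring
    rw [h5] at h4
    simpa using h4
  exact (uniqueDiffOn_Ici t₀ t₀ self_mem_Ici).eq_deriv _ h1 h3

/-- **Isotropic kernel.**  If `T ≠ 0` and `T·γ(m+τ) + T·τ·γ'(m+τ) = l + ρτ` for all `τ ≥ 0`, then `γ(m+τ) = l/T + (ρ/(2T))τ` for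
`τ ≥ 0` and `γ'(m+τ) = ρ/(2T)` for `τ > 0`: the function `τγ(m+τ) − (lτ + ρτ²/2)/T` has zero derivative on `(0,∞)` and vanishes at
`0`. [folklore] -/
theorem isotropic_kernel {γ γ' : ℝ → ℝ} {m T l ρ : ℝ} (hT : T ≠ 0) (hγ : ∀ t, HasDerivAt γ (γ' t) t)
    (h : ∀ τ, 0 ≤ τ → T * γ (m + τ) + T * τ * γ' (m + τ) = l + ρ * τ) :
    (∀ τ, 0 ≤ τ → γ (m + τ) = l / T + ρ / (2 * T) * τ) ∧ (∀ τ, 0 < τ → γ' (m + τ) = ρ / (2 * T)) := by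
  have hH : ∀ τ, HasDerivAt (fun τ => τ * γ (m + τ) - (l * τ + ρ * (τ * τ) / 2) / T)
      (1 * γ (m + τ) + τ * γ' (m + τ) - (l + ρ * (1 * τ + τ * 1) / 2) / T) τ := by
    intro τ
    have h1 : HasDerivAt (fun τ => γ (m + τ)) (γ' (m + τ)) τ := HasDerivAt.comp_const_add m τ (hγ (m + τ))
    have h2 : HasDerivAt (fun τ : ℝ => τ * γ (m + τ)) (1 * γ (m + τ) + τ * γ' (m + τ)) τ :=
      (hasDerivAt_id τ).fun_mul h1
    have h3 : HasDerivAt (fun τ : ℝ => (l * τ + ρ * (τ * τ) / 2) / T) ((l + ρ * (1 * τ + τ * 1) / 2) / T) τ := by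
      have h4 : HasDerivAt (fun τ : ℝ => l * τ + ρ * (τ * τ) / 2) (l + ρ * (1 * τ + τ * 1) / 2) τ :=
        (hasDerivAt_const_mul l).fun_add
          ((((hasDerivAt_id τ).fun_mul (hasDerivAt_id τ)).const_mul ρ).div_const 2)
      exact h4.div_const T
    exact h2.fun_sub h3
  have hval : ∀ τ, 0 < τ → τ * γ (m + τ) - (l * τ + ρ * (τ * τ) / 2) / T = 0 := by
    intro τ hτ
    obtain ⟨ξ, hξ, hslope⟩ := exists_hasDerivAt_eq_slope
      (fun τ => τ * γ (m + τ) - (l * τ + ρ * (τ * τ) / 2) / T)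
      (fun τ => 1 * γ (m + τ) + τ * γ' (m + τ) - (l + ρ * (1 * τ + τ * 1) / 2) / T) hτ
      (fun t _ => (hH t).continuousAt.continuousWithinAt) (fun t _ => hH t)
    have hzero : 1 * γ (m + ξ) + ξ * γ' (m + ξ) - (l + ρ * (1 * ξ + ξ * 1) / 2) / T = 0 := by
      have h1 := h ξ hξ.1.le
      have h2 : (l + ρ * (1 * ξ + ξ * 1) / 2) / T = γ (m + ξ) + ξ * γ' (m + ξ) := by
        rw [div_eq_iff hT]
        linear_combination (-1 : ℝ) * h1
      rw [h2]; ring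
    rw [hzero] at hslope
    have h2 := (div_eq_zero_iff.mp hslope.symm)
    rcases h2 with h2 | h2
    · simpa using h2
    · exfalso; exact hτ.ne' (by simpa using h2)
  have hγm : γ m = l / T := by
    have h0 := h 0 le_rfl
    simp only [add_zero, mul_zero, zero_mul] at h0
    rw [eq_div_iff hT]
    linear_combination h0
  have part1 : ∀ τ, 0 ≤ τ → γ (m + τ) = l / T + ρ / (2 * T) * τ := by
    intro τ hτ
    rcases hτ.eq_or_lt with h0 | hpos
    · rw [← h0, add_zero, mul_zero, add_zero]; exact hγm
    · have h1 := hval τ hpos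
      have hτne : τ ≠ 0 := hpos.ne'
      have h2 : τ * γ (m + τ) = (l * τ + ρ * (τ * τ) / 2) / T := by linarith
      have h3 : γ (m + τ) = ((l * τ + ρ * (τ * τ) / 2) / T) / τ := by
        rw [eq_div_iff hτne]; linear_combination h2
      rw [h3]; field_simp
  refine ⟨part1, ?_⟩
  intro τ hτ
  have h1 := h τ hτ.le
  rw [part1 τ hτ.le] at h1
  have hτne : τ ≠ 0 := hτ.ne'
  have h3 : T * (l / T + ρ / (2 * T) * τ) = l + ρ * τ / 2 := by field_simp
  have h2 : T * τ * γ' (m + τ) = ρ * τ / 2 := by linarith [h1, h3]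
  have h4 : τ * (γ' (m + τ) * (2 * T)) = τ * ρ := by linear_combination 2 * h2
  rw [eq_div_iff (mul_ne_zero two_ne_zero hT)]
  exact mul_left_cancel₀ hτne h4

/-- **Two ray identities with different weights pin the derivative.**  If `T·γ(m+τ) + σᵢ·τ·γ'(m+τ) = l + ρᵢ·τ` for all `τ ≥ 0`
(`i = 1, 2`) with `σ₁ ≠ σ₂`, then `γ'(m+τ) = (ρ₁ − ρ₂)/(σ₁ − σ₂)` for every `τ > 0`. [folklore] -/
theorem deriv_eq_of_two_rays {γ γ' : ℝ → ℝ} {m T l σ₁ σ₂ ρ₁ ρ₂ : ℝ} (hσ : σ₁ ≠ σ₂)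
    (h₁ : ∀ τ, 0 ≤ τ → T * γ (m + τ) + σ₁ * τ * γ' (m + τ) = l + ρ₁ * τ)
    (h₂ : ∀ τ, 0 ≤ τ → T * γ (m + τ) + σ₂ * τ * γ' (m + τ) = l + ρ₂ * τ) :
    ∀ τ, 0 < τ → γ' (m + τ) = (ρ₁ - ρ₂) / (σ₁ - σ₂) := by
  intro τ hτ
  have e1 := h₁ τ hτ.le
  have e2 := h₂ τ hτ.le
  have hne : σ₁ - σ₂ ≠ 0 := sub_ne_zero.mpr hσ
  have h3 : (σ₁ - σ₂) * τ * γ' (m + τ) = (ρ₁ - ρ₂) * τ := by linear_combination e1 - e2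
  rw [eq_div_iff hne]
  have hτne : τ ≠ 0 := hτ.ne'
  have h4 : τ * (γ' (m + τ) * (σ₁ - σ₂) - (ρ₁ - ρ₂)) = 0 := by linear_combination h3
  rcases mul_eq_zero.mp h4 with h5 | h5
  · exact absurd h5 hτne
  · linear_combination h5

/-! ## Single-height rigidity for a definite quadratic slice -/

/-- ★ **A positive definite quadratic slice at ONE height makes the structure function affine on its value range.**  Let `γ` be
differentiable with derivative `γ'`, and let the quadratic slice `W(y) = A + By₀ + Cy₁ + ½(Dy₀² + 2Ey₀y₁ + Gy₁²)` with `D > 0`,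
`DG − E² > 0` satisfy `ℓ(y) = γ(W(y))(D + G) + γ'(W(y))·P(y)` for all `y`, where `P = |∇W|²` and `ℓ` is ANY quadratic polynomial
(the height-evolution `∂ₛ∂ₛW = γ(W)ΔW + γ'(W)|∇W|²` read at one height).  Then there are `m, γ₀, μ` with: `W ≥ m` everywhere; `W = m`
only where `P = 0`; `γ(m + τ) = γ₀ + 2μ(m + τ)` for all `τ ≥ 0`; `γ'(m + τ) = 2μ` for all `τ > 0`.  (Rays from the centre, parity,
three directions, and the isotropic kernel — see the module docstring.) [folklore] -/
theorem quadSlice_posDef_affine {γ γ' : ℝ → ℝ} (hγ : ∀ t, HasDerivAt γ (γ' t) t)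
    {A B C D E G a b c d e g : ℝ} {W P ℓ : ℝ → ℝ → ℝ}
    (hW : ∀ y₀ y₁, W y₀ y₁ = A + B * y₀ + C * y₁ + (D * y₀ ^ 2 + 2 * E * y₀ * y₁ + G * y₁ ^ 2) / 2)
    (hP : ∀ y₀ y₁, P y₀ y₁ = (B + D * y₀ + E * y₁) ^ 2 + (C + E * y₀ + G * y₁) ^ 2)
    (hℓ : ∀ y₀ y₁, ℓ y₀ y₁ = a + b * y₀ + c * y₁ + (d * y₀ ^ 2 + 2 * e * y₀ * y₁ + g * y₁ ^ 2) / 2)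
    (hD : 0 < D) (hdet : 0 < D * G - E ^ 2)
    (hpde : ∀ y₀ y₁, ℓ y₀ y₁ = γ (W y₀ y₁) * (D + G) + γ' (W y₀ y₁) * P y₀ y₁) :
    ∃ m γ₀ μ : ℝ, (∀ y₀ y₁, m ≤ W y₀ y₁) ∧ (∀ y₀ y₁, W y₀ y₁ = m → P y₀ y₁ = 0) ∧
      (∀ τ, 0 ≤ τ → γ (m + τ) = γ₀ + 2 * μ * (m + τ)) ∧ (∀ τ, 0 < τ → γ' (m + τ) = 2 * μ) := by
  have hG : 0 < G := by nlinarith [sq_nonneg E]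
  have hT : 0 < D + G := by linarith
  -- the centre `c` of the slice: `∇W(c) = 0`
  have hδ : D * G - E ^ 2 ≠ 0 := hdet.ne'
  have hδ' : G * D - E ^ 2 ≠ 0 := by rw [mul_comm]; exact hδ
  obtain ⟨c₀, c₁, hcen₀, hcen₁⟩ : ∃ c₀ c₁ : ℝ, B + D * c₀ + E * c₁ = 0 ∧ C + E * c₀ + G * c₁ = 0 := by
    refine ⟨(E * C - G * B) / (D * G - E ^ 2), (E * B - D * C) / (D * G - E ^ 2), ?_, ?_⟩
    · field_simp; ring
    · field_simp; ring
  set m := W c₀ c₁ with hm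
  -- expansions along the rays `y = c + t·d`
  have hWray : ∀ t d₀ d₁ : ℝ, W (c₀ + t * d₀) (c₁ + t * d₁) =
      m + t ^ 2 * (D * d₀ ^ 2 + 2 * E * d₀ * d₁ + G * d₁ ^ 2) / 2 := by
    intro t d₀ d₁
    rw [hW, hm, hW]
    linear_combination (t * d₀) * hcen₀ + (t * d₁) * hcen₁
  have hPray : ∀ t d₀ d₁ : ℝ, P (c₀ + t * d₀) (c₁ + t * d₁) =
      t ^ 2 * ((D * d₀ + E * d₁) ^ 2 + (E * d₀ + G * d₁) ^ 2) := by
    intro t d₀ d₁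
    rw [hP]
    have h1 : B + D * (c₀ + t * d₀) + E * (c₁ + t * d₁) = t * (D * d₀ + E * d₁) := by linear_combination hcen₀
    have h2 : C + E * (c₀ + t * d₀) + G * (c₁ + t * d₁) = t * (E * d₀ + G * d₁) := by linear_combination hcen₁
    rw [h1, h2]; ring
  have hℓray : ∀ t d₀ d₁ : ℝ, ℓ (c₀ + t * d₀) (c₁ + t * d₁) + ℓ (c₀ + (-t) * d₀) (c₁ + (-t) * d₁) =
      2 * ℓ c₀ c₁ + t ^ 2 * (d * d₀ ^ 2 + 2 * e * d₀ * d₁ + g * d₁ ^ 2) := by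
    intro t d₀ d₁
    rw [hℓ, hℓ, hℓ]; ring
  have e0 : ∀ y₀ : ℝ, c₀ + 1 * (y₀ - c₀) = y₀ := fun _ => by ring
  have e1 : ∀ y₁ : ℝ, c₁ + 1 * (y₁ - c₁) = y₁ := fun _ => by ring
  -- the value range lies in `[m, ∞)` and `P ≤ 2(D+G)(W − m)` (so `W = m` forces `P = 0`)
  have hPle : ∀ y₀ y₁, P y₀ y₁ ≤ 2 * (D + G) * (W y₀ y₁ - m) := by
    intro y₀ y₁
    have hWy := hWray 1 (y₀ - c₀) (y₁ - c₁)
    have hPy := hPray 1 (y₀ - c₀) (y₁ - c₁)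
    rw [e0, e1] at hWy hPy
    rw [hWy, hPy]
    have key : (D + G) * (D * (y₀ - c₀) ^ 2 + 2 * E * (y₀ - c₀) * (y₁ - c₁) + G * (y₁ - c₁) ^ 2) -
        ((D * (y₀ - c₀) + E * (y₁ - c₁)) ^ 2 + (E * (y₀ - c₀) + G * (y₁ - c₁)) ^ 2) =
        (D * G - E ^ 2) * ((y₀ - c₀) ^ 2 + (y₁ - c₁) ^ 2) := by ring
    nlinarith [key, mul_nonneg hdet.le (add_nonneg (sq_nonneg (y₀ - c₀)) (sq_nonneg (y₁ - c₁)))]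
  have hPnn : ∀ y₀ y₁, 0 ≤ P y₀ y₁ := by
    intro y₀ y₁; rw [hP]; positivity
  have hlow : ∀ y₀ y₁, m ≤ W y₀ y₁ := by
    intro y₀ y₁
    nlinarith [hPle y₀ y₁, hPnn y₀ y₁]
  have hbot : ∀ y₀ y₁, W y₀ y₁ = m → P y₀ y₁ = 0 := by
    intro y₀ y₁ h
    have h1 := hPle y₀ y₁
    rw [h, sub_self, mul_zero] at h1
    exact le_antisymm h1 (hPnn y₀ y₁)
  -- the RAY IDENTITY: adding the slice identity at `c ± t d` kills the odd part of `ℓ`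
  have ray : ∀ d₀ d₁ q p r : ℝ, q = D * d₀ ^ 2 + 2 * E * d₀ * d₁ + G * d₁ ^ 2 →
      p = (D * d₀ + E * d₁) ^ 2 + (E * d₀ + G * d₁) ^ 2 → r = d * d₀ ^ 2 + 2 * e * d₀ * d₁ + g * d₁ ^ 2 →
      0 < q → ∀ τ, 0 ≤ τ →
      (D + G) * γ (m + τ) + (2 * p / q) * τ * γ' (m + τ) = ℓ c₀ c₁ + (r / q) * τ := by
    intro d₀ d₁ q p r hq hp hr hqpos τ hτ
    have hqne : q ≠ 0 := hqpos.ne'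
    set t := Real.sqrt (2 * τ / q) with ht
    have ht2 : t ^ 2 = 2 * τ / q := by
      rw [ht, Real.sq_sqrt (div_nonneg (by linarith) hqpos.le)]
    have hnt2 : (-t) ^ 2 = 2 * τ / q := by rw [neg_sq, ht2]
    have hWp : W (c₀ + t * d₀) (c₁ + t * d₁) = m + τ := by
      rw [hWray, ← hq, ht2]; field_simp
    have hWn : W (c₀ + (-t) * d₀) (c₁ + (-t) * d₁) = m + τ := by
      rw [hWray, ← hq, hnt2]; field_simp
    have hPp : P (c₀ + t * d₀) (c₁ + t * d₁) = 2 * τ / q * p := by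
      rw [hPray, ← hp, ht2]
    have hPn : P (c₀ + (-t) * d₀) (c₁ + (-t) * d₁) = 2 * τ / q * p := by
      rw [hPray, ← hp, hnt2]
    have h1 := hpde (c₀ + t * d₀) (c₁ + t * d₁)
    have h2 := hpde (c₀ + (-t) * d₀) (c₁ + (-t) * d₁)
    have h3 := hℓray t d₀ d₁
    rw [hWp, hPp] at h1
    rw [hWn, hPn] at h2
    rw [← hr, ht2] at h3
    linear_combination (h3 - h1 - h2) / 2
  -- three directions: e₀, e₁, e₀ + e₁
  have hq₃ : 0 < D + 2 * E + G := by
    have h4 : 0 < (D + G) ^ 2 - 4 * E ^ 2 := by nlinarith [sq_nonneg (D - G)]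
    by_contra hle
    have hle' : D + 2 * E + G ≤ 0 := not_lt.mp hle
    have h5 : 0 ≤ -(D + 2 * E + G) := by linarith
    have h6 : 0 < D + G - 2 * E := by linarith
    have h7 : (D + G) ^ 2 - 4 * E ^ 2 = (D + G - 2 * E) * (D + 2 * E + G) := by ring
    nlinarith [mul_nonneg h6.le h5]
  have ray₁ := ray 1 0 D (D ^ 2 + E ^ 2) d (by ring) (by ring) (by ring) hD
  have ray₂ := ray 0 1 G (E ^ 2 + G ^ 2) g (by ring) (by ring) (by ring) hG
  have ray₃ := ray 1 1 (D + 2 * E + G) ((D + E) ^ 2 + (E + G) ^ 2) (d + 2 * e + g)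
    (by ring) (by ring) (by ring) hq₃
  -- packaging: a constant derivative on `(m, ∞)` is all we need
  have finish : ∀ k : ℝ, (∀ τ, 0 < τ → γ' (m + τ) = k) →
      ∃ m' γ₀ μ : ℝ, (∀ y₀ y₁, m' ≤ W y₀ y₁) ∧ (∀ y₀ y₁, W y₀ y₁ = m' → P y₀ y₁ = 0) ∧
        (∀ τ, 0 ≤ τ → γ (m' + τ) = γ₀ + 2 * μ * (m' + τ)) ∧ (∀ τ, 0 < τ → γ' (m' + τ) = 2 * μ) := by
    intro k hk
    refine ⟨m, γ m - k * m, k / 2, hlow, hbot, ?_, ?_⟩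
    · intro τ hτ; rw [eq_affine_of_deriv_eq_Ioi hγ hk τ hτ]; ring
    · intro τ hτ; rw [hk τ hτ]; ring
  by_cases h12 : 2 * (D ^ 2 + E ^ 2) / D = 2 * (E ^ 2 + G ^ 2) / G
  · by_cases h13 : 2 * (D ^ 2 + E ^ 2) / D = 2 * ((D + E) ^ 2 + (E + G) ^ 2) / (D + 2 * E + G)
    · -- all three weights agree: the slice is ISOTROPIC
      have h12' := h12
      rw [div_eq_div_iff hD.ne' hG.ne'] at h12'
      have hDG : D = G := by
        have h8 : (D - G) * (D * G - E ^ 2) = 0 := by linear_combination h12' / 2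
        rcases mul_eq_zero.mp h8 with h9 | h9
        · linarith
        · exact absurd h9 hdet.ne'
      have h13' := h13
      rw [div_eq_div_iff hD.ne' hq₃.ne'] at h13'
      rw [← hDG] at h13' hdet
      have hE : E = 0 := by
        have h8 : E * (D + E) * (E - D) = 0 := by linear_combination h13' / 4
        rcases mul_eq_zero.mp h8 with h9 | h9
        · rcases mul_eq_zero.mp h9 with h10 | h10
          · exact h10
          · exfalso
            have : E = -D := by linarith
            rw [this] at hdet; nlinarith
        · exfalso
          have : E = D := by linarith
          rw [this] at hdet; nlinarith
      have hcoef : 2 * (D ^ 2 + E ^ 2) / D = D + G := by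
        rw [hE, ← hDG]; field_simp; ring
      rw [hcoef] at ray₁
      have hiso : ∀ τ, 0 ≤ τ → (D + G) * γ (m + τ) + (D + G) * τ * γ' (m + τ) = ℓ c₀ c₁ + (d / D) * τ :=
        fun τ hτ => ray₁ τ hτ
      exact finish _ (isotropic_kernel hT.ne' hγ hiso).2
    · exact finish _ (deriv_eq_of_two_rays h13 ray₁ ray₃)
  · exact finish _ (deriv_eq_of_two_rays h12 ray₁ ray₂)

end Summit.NavierStokesRegularity.NavierStokesRegularity.Theorems.PoloidalWindowDoorPoloidalWindowRigidityZShockTurningShearDefinite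

end
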